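import Summits.AtomisticToContinuum.BoseEinsteinCondensation.Theses.BECStronglyRayleigh
import Summits.AtomisticToContinuum.BoseEinsteinCondensation.Theorems.InsertionFieldDelocalisation.Negative.Toolkit
import Summits.AtomisticToContinuum.BoseEinsteinCondensation.Theorems.InsertionFieldDelocalisation.Negative.Tightness
import Summits.AtomisticToContinuum.BoseEinsteinCondensation.Theorems.InsertionFieldDelocalisation.Negative.PerronExistence
import Summits.AtomisticToContinuum.BoseEinsteinCondensation.Theorems.BECStronglyRayleighInsertionFieldDelocalisationEmbedding
import Literature.MathematicalPhysics.QuantumLattice.FinDimSpectrumSectorGibbsLimit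
import HarnessLib

/-!
# DREFUTE workfile — line `cosh-budget-penrose-onsager` (crux stmt-AtomisticToContinuum-9673, K1)

Refuter seat refuter-drefute-stmt-AtomisticToContinuum-9673-g2-0, 2026-08-16 (second line of the session;
companion of the report `DREFUTE-cosh-budget-penrose-onsager.md`).  Findings as theorems, all `sorry`-free,
axioms standard; the same declarations are proposed for landing under the
`…Theorems.InsertionFieldDelocalisation.Negative` namespace as `Negative/TorusDegreePairEnergy.lean`
(p89978) and `Negative/CoshBudgetLoadBearing.lean` (to follow once the first is built) — import THOSE once
accepted; this copy lives under a Cruxes namespace only so that the crux directory carries the checked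
content at once.

* `torus_degree_le_six`, `torus_degree_eq_six` (`L ≥ 3`), `five_le_hops`, `ten_le_hops_pair` — the
  torus graph is 6-regular for `L ≥ 3` (kinetic-normalisation input of the line).
* `lowestEnergy_two_le_neg_five` — `E(2) ≤ -5` for `L ≥ 3` (flat pair trial vector).
* `poExcessBudget_false_without_groundState` — `stub_poExcessBudget` minus the eigen-equation of `ψ'`:
  FALSE (one frozen boson: its PO vector has `⟨Φ,HΦ⟩ ≥ -3‖Φ‖²` against `E(2) ≤ -5`).  Any proof of the
  `O(L⁻³)` budget must use that `ψ'` is a ground vector.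

Stub set attacked (lead's def-free skeleton `Lines/cosh_budget_penrose_onsager.lean`): 0 stub-false,
0 stub-misstated, 6 survived (paper audit + numerics in the report).
-/

noncomputable section

namespace Summit.AtomisticToContinuum.BoseEinsteinCondensation.Cruxes.InsertionFieldDelocalisation.DrefuteCoshBudget

open scoped BigOperators ComplexOrder
open Literature.MathematicalPhysics.QuantumLattice Literature.Probability.LatticeModels Matrix Finset
open Summit.AtomisticToContinuum.BoseEinsteinCondensation.Theses.BECStronglyRayleigh
open Summit.AtomisticToContinuum.BoseEinsteinCondensation.Theorems.InsertionFieldDelocalisation.Negative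

/-! ### Degrees of the torus graph `(ℤ/Lℤ)³` -/

variable {L : ℕ}

/-- Every neighbour of `x` is `x ± eᵢ`. [folklore] -/
theorem torus_neighbors_subset [NeZero L] (x : TorusSite 3 L) :
    (Finset.univ.filter fun y => (torusGraph 3 L).Adj x y) ⊆
      (Finset.univ : Finset (Fin 3 × Bool)).image
        (fun p => x + (if p.2 then Pi.single p.1 1 else -Pi.single p.1 1)) := by
  intro y hy
  rw [Finset.mem_filter] at hy
  obtain ⟨-, ⟨i, hi⟩ | ⟨i, hi⟩⟩ := (torusGraph_adj_iff x y).mp hy.2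
  · exact Finset.mem_image.mpr ⟨(i, true), Finset.mem_univ _, by simp [hi]⟩
  · refine Finset.mem_image.mpr ⟨(i, false), Finset.mem_univ _, ?_⟩
    rw [hi]
    simp

/-- **Degree at most six** on `(ℤ/Lℤ)³`. [folklore] -/
theorem torus_degree_le_six [NeZero L] (x : TorusSite 3 L) :
    (Finset.univ.filter fun y => (torusGraph 3 L).Adj x y).card ≤ 6 := by
  refine (Finset.card_le_card (torus_neighbors_subset x)).trans ?_
  refine Finset.card_image_le.trans ?_
  simp

/-- **Six distinct neighbours** for `L ≥ 3`: `x ± eᵢ`. [folklore] -/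
theorem torus_degree_eq_six [NeZero L] (hL : 3 ≤ L) (x : TorusSite 3 L) :
    (Finset.univ.filter fun y => (torusGraph 3 L).Adj x y).card = 6 := by
  haveI : Fact (1 < L) := ⟨by omega⟩
  have h1 : (1 : ZMod L) ≠ 0 := one_ne_zero
  have hm1 : (-1 : ZMod L) ≠ 0 := neg_ne_zero.mpr h1
  have h11 : (1 : ZMod L) + 1 ≠ 0 := by
    -- `2 ≠ 0` in `ℤ/L` for `L ≥ 3` (cf. `zmod_one_add_one_ne_zero_of_three_le` in the Hubbard torus file)
    intro h
    have h2 : ((2 : ℕ) : ZMod L) = 0 := by push_cast; rw [← h]; ring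
    have := congrArg ZMod.val h2
    rw [ZMod.val_natCast, Nat.mod_eq_of_lt (by omega), ZMod.val_zero] at this
    omega
  have h2 : (1 : ZMod L) ≠ -1 := by
    intro h
    exact h11 (by linear_combination h)
  set g : Fin 3 × Bool → TorusSite 3 L :=
    fun p => if p.2 then Pi.single p.1 1 else -Pi.single p.1 1 with hg
  have hgi : ∀ (i : Fin 3) (b : Bool), g (i, b) i = if b then 1 else -1 := by
    intro i b; cases b <;> simp [hg]
  have hgj : ∀ (i j : Fin 3) (b : Bool), i ≠ j → g (i, b) j = 0 := by
    intro i j b hij; cases b <;> simp [hg, Pi.single_eq_of_ne (Ne.symm hij)]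
  have hg0 : ∀ p, g p ≠ 0 := by
    rintro ⟨i, b⟩ h
    have := congrFun h i
    rw [hgi] at this
    cases b
    · simp only [Bool.false_eq_true, if_false, Pi.zero_apply] at this
      exact hm1 this
    · simp only [if_true, Pi.zero_apply] at this
      exact h1 this
  -- `p ↦ x + g p` is injective
  have hinj : Function.Injective (fun p => x + g p) := by
    rintro ⟨i, b⟩ ⟨j, c⟩ hpq
    have key : g (i, b) = g (j, c) := add_left_cancel hpq
    by_cases hij : i = j
    · subst hij
      have := congrFun key i
      rw [hgi, hgi] at this
      cases b <;> cases c
      · rfl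
      · exact absurd this.symm h2
      · exact absurd this h2
      · rfl
    · exfalso
      have := congrFun key i
      rw [hgi, hgj j i c (Ne.symm hij)] at this
      cases b
      · simp only [Bool.false_eq_true, if_false] at this
        exact hm1 this
      · simp only [if_true] at this
        exact h1 this
  -- every image point is a neighbour
  have hsub : (Finset.univ : Finset (Fin 3 × Bool)).image (fun p => x + g p) ⊆
      Finset.univ.filter fun y => (torusGraph 3 L).Adj x y := by
    intro y hy
    obtain ⟨⟨i, b⟩, -, rfl⟩ := Finset.mem_image.mp hy
    rw [Finset.mem_filter]
    refine ⟨Finset.mem_univ _, ?_⟩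
    rw [torusGraph_adj_iff]
    refine ⟨fun h => hg0 (i, b) (left_eq_add.mp h), ?_⟩
    cases b
    · right
      exact ⟨i, by simp [hg]⟩
    · left
      exact ⟨i, by simp [hg]⟩
  apply le_antisymm (torus_degree_le_six x)
  calc 6 = ((Finset.univ : Finset (Fin 3 × Bool)).image (fun p => x + g p)).card := by
        rw [Finset.card_image_of_injective _ hinj]; simp
    _ ≤ _ := Finset.card_le_card hsub

/-- From a vertex of a two-set at least five hops leave the set (`L ≥ 3`). [folklore] -/
theorem five_le_hops [NeZero L] (hL : 3 ≤ L) {a c : TorusSite 3 L} (hac : a ≠ c) :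
    5 ≤ (Finset.univ.filter fun b => b ∉ ({a, c} : Finset (TorusSite 3 L)) ∧
      (torusGraph 3 L).Adj a b).card := by
  have hsub : (Finset.univ.filter fun y => (torusGraph 3 L).Adj a y) \ {c} ⊆
      Finset.univ.filter fun b => b ∉ ({a, c} : Finset (TorusSite 3 L)) ∧ (torusGraph 3 L).Adj a b := by
    intro b hb
    rw [Finset.mem_sdiff, Finset.mem_filter, Finset.mem_singleton] at hb
    rw [Finset.mem_filter, Finset.mem_insert, Finset.mem_singleton]
    refine ⟨Finset.mem_univ _, ?_, hb.1.2⟩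
    rintro (rfl | rfl)
    · exact hb.1.2.ne rfl
    · exact hb.2 rfl
  have h6 := torus_degree_eq_six hL a
  have hcard := Finset.card_le_card hsub
  have hsd : (Finset.univ.filter fun y => (torusGraph 3 L).Adj a y).card ≤
      ((Finset.univ.filter fun y => (torusGraph 3 L).Adj a y) \ {c}).card + ({c} : Finset _).card :=
    Finset.card_le_card_sdiff_add_card
  rw [Finset.card_singleton, h6] at hsd
  omega

/-! ### The pair energy: `E(2) ≤ -5` on `(ℤ/Lℤ)³`, `L ≥ 3` (flat pair trial vector) -/

/-- The occupied set of an indicator configuration is the set. [folklore] -/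
theorem filter_ind_eq_zero [NeZero L] (S : Finset (TorusSite 3 L)) :
    (Finset.univ.filter fun z => (if z ∈ S then (0 : Fin 2) else 1) = 0) = S := by
  ext z
  simp

/-- The number of hops out of a two-set is at least ten (`L ≥ 3`). [folklore] -/
theorem ten_le_hops_pair [NeZero L] (hL : 3 ≤ L) {S : Finset (TorusSite 3 L)} (hS : S.card = 2) :
    (10 : ℝ) ≤ ∑ a ∈ S, ∑ b : TorusSite 3 L,
      (if b ∉ S ∧ (torusGraph 3 L).Adj a b then (1 : ℝ) else 0) := by
  obtain ⟨a, c, hac, rfl⟩ := Finset.card_eq_two.mp hS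
  rw [Finset.sum_pair hac]
  have ha := five_le_hops hL hac
  have hc := five_le_hops hL (Ne.symm hac)
  rw [Finset.pair_comm c a] at hc
  rw [Finset.sum_boole, Finset.sum_boole]
  have ha' : (5 : ℝ) ≤ ((Finset.univ.filter fun b => b ∉ ({a, c} : Finset (TorusSite 3 L)) ∧
      (torusGraph 3 L).Adj a b).card : ℝ) := by exact_mod_cast ha
  have hc' : (5 : ℝ) ≤ ((Finset.univ.filter fun b => b ∉ ({a, c} : Finset (TorusSite 3 L)) ∧
      (torusGraph 3 L).Adj c b).card : ℝ) := by exact_mod_cast hc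
  linarith

/-- **`E(2) ≤ -5` for `L ≥ 3`**: the flat vector on two-sets has Rayleigh quotient
`-½ · (mean number of hops) ≤ -5`, since each of the two particles keeps at least five of its six moves
(`torus_degree_eq_six`); variational principle `minEnergyOn_le_rayleigh_of_mem`. [folklore] -/
theorem lowestEnergy_two_le_neg_five [NeZero L] (hL : 3 ≤ L) :
    lowestEnergyInSector 1 (xyTorus 3 L 1) (((2 : ℕ) : ℝ) - (L : ℝ) ^ 3 / 2) ≤ -5 := by
  -- the flat pair vector and its support predicate
  set φ : TensorIndex (TorusSite 3 L) 2 → ℂ :=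
    fun σ => if (Finset.univ.filter fun z => σ z = 0).card = 2 then 1 else 0 with hφ
  have hφP : ∀ σ, (Finset.univ.filter fun z => σ z = 0).card = 2 → φ σ = 1 := fun σ h => by
    simp [hφ, h]
  have hφN : ∀ σ, (Finset.univ.filter fun z => σ z = 0).card ≠ 2 → φ σ = 0 := fun σ h => by
    simp [hφ, h]
  have hφind : ∀ T : Finset (TorusSite 3 L), T.card = 2 →
      φ (fun z => if z ∈ T then 0 else 1) = 1 := by
    intro T hT
    apply hφP
    rw [filter_ind_eq_zero, hT]
  -- sector membership
  have hsec : φ ∈ spinZSector 1 (((2 : ℕ) : ℝ) - (L : ℝ) ^ 3 / 2) := by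
    rw [LiebMattis.mem_spinZSector_iff]
    intro σ hσ
    have hP : (Finset.univ.filter fun z => σ z = 0).card = 2 := by
      by_contra h; exact hσ (hφN σ h)
    have hσeq := ind_filter_eq σ
    have key : (∑ x, ((((1 : ℕ) : ℂ)) / 2 - ((σ x : ℕ) : ℂ))) =
        ∑ x, ((((1 : ℕ) : ℂ)) / 2 - (((if x ∈ Finset.univ.filter (fun z => σ z = 0) then (0 : Fin 2)
          else 1 : Fin 2) : ℕ) : ℂ)) :=
      Finset.sum_congr rfl fun x _ => by rw [← congrFun hσeq x]
    rw [key, magnetisation_ind, hP, card_torusSite 3 L]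
    push_cast
    ring
  -- the row formula on the support: `Re (Hφ)(1_S) ≤ -5`
  have hrow : ∀ σ, (Finset.univ.filter fun z => σ z = 0).card = 2 →
      ((xyTorus 3 L 1 *ᵥ φ) σ).re ≤ -5 := by
    intro σ hP
    set S := Finset.univ.filter fun z => σ z = 0 with hS
    have hσeq : (fun z => if z ∈ S then (0 : Fin 2) else 1) = σ := ind_filter_eq σ
    rw [← hσeq]
    rw [show xyTorus 3 L 1 = xxzHamiltonian 1 (torusGraph 3 L) (-1) 0 from rfl,
      Cruxes.InsertionFieldDelocalisation.MobileTrapDirichletEigenfunction.mt3em_xxzZero_mulVec_ind]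
    -- every target configuration is again a two-set, so `φ = 1` there
    have hterm : ∀ a ∈ S, ∀ b : TorusSite 3 L,
        (if b ∉ S ∧ (torusGraph 3 L).Adj a b then
          φ (fun z => if z ∈ insert b (S.erase a) then 0 else 1) else 0) =
        ((if b ∉ S ∧ (torusGraph 3 L).Adj a b then (1 : ℝ) else 0 : ℝ) : ℂ) := by
      intro a ha b
      by_cases h : b ∉ S ∧ (torusGraph 3 L).Adj a b
      · rw [if_pos h, if_pos h, hφind]
        · simp
        · rw [Finset.card_insert_of_notMem (fun hb => h.1 (Finset.mem_of_mem_erase hb)),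
            Finset.card_erase_of_mem ha, hP]
      · rw [if_neg h, if_neg h]; simp
    rw [Finset.sum_congr rfl fun a ha => Finset.sum_congr rfl fun b _ => hterm a ha b]
    have hcast : (∑ a ∈ S, ∑ b : TorusSite 3 L,
        (((if b ∉ S ∧ (torusGraph 3 L).Adj a b then (1 : ℝ) else 0 : ℝ)) : ℂ)) =
        ((∑ a ∈ S, ∑ b : TorusSite 3 L,
          (if b ∉ S ∧ (torusGraph 3 L).Adj a b then (1 : ℝ) else 0) : ℝ) : ℂ) := by
      rw [Complex.ofReal_sum]
      exact Finset.sum_congr rfl fun a _ => (Complex.ofReal_sum _ _).symm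
    rw [hcast, ← Complex.ofReal_mul, Complex.ofReal_re]
    have h10 := ten_le_hops_pair hL hP
    linarith
  -- the two dot products of `φ`
  set n : ℕ := (Finset.univ.filter fun σ : TensorIndex (TorusSite 3 L) 2 =>
      (Finset.univ.filter fun z => σ z = 0).card = 2).card with hn
  have hnorm : star φ ⬝ᵥ φ = (n : ℂ) := by
    rw [dotProduct]
    have hterm : ∀ σ : TensorIndex (TorusSite 3 L) 2, star φ σ * φ σ =
        if (Finset.univ.filter fun z => σ z = 0).card = 2 then (1 : ℂ) else 0 := by
      intro σ
      rw [Pi.star_apply]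
      by_cases h : (Finset.univ.filter fun z => σ z = 0).card = 2
      · rw [hφP σ h, if_pos h]; simp
      · rw [hφN σ h, if_neg h]; simp
    rw [Finset.sum_congr rfl fun σ _ => hterm σ, Finset.sum_boole, hn]
  have hquad : (star φ ⬝ᵥ (xyTorus 3 L 1 *ᵥ φ)).re ≤ -5 * n := by
    rw [dotProduct, Complex.re_sum]
    have hterm : ∀ σ : TensorIndex (TorusSite 3 L) 2, (star φ σ * (xyTorus 3 L 1 *ᵥ φ) σ).re ≤
        if (Finset.univ.filter fun z => σ z = 0).card = 2 then (-5 : ℝ) else 0 := by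
      intro σ
      rw [Pi.star_apply]
      by_cases h : (Finset.univ.filter fun z => σ z = 0).card = 2
      · rw [hφP σ h, if_pos h, star_one, one_mul]
        exact hrow σ h
      · rw [hφN σ h, if_neg h, star_zero, zero_mul, Complex.zero_re]
    calc ∑ σ, (star φ σ * (xyTorus 3 L 1 *ᵥ φ) σ).re
        ≤ ∑ σ : TensorIndex (TorusSite 3 L) 2,
            (if (Finset.univ.filter fun z => σ z = 0).card = 2 then (-5 : ℝ) else 0) :=
          Finset.sum_le_sum fun σ _ => hterm σ
      _ = -5 * n := by
          rw [Finset.sum_ite, Finset.sum_const_zero, add_zero, Finset.sum_const, nsmul_eq_mul, hn]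
          ring
  have hnpos : 0 < n := by
    obtain ⟨a, b, hab⟩ := exists_pair_torusSite L (by omega)
    rw [hn, Finset.card_pos]
    refine ⟨fun z => if z ∈ ({a, b} : Finset (TorusSite 3 L)) then 0 else 1, ?_⟩
    rw [Finset.mem_filter]
    refine ⟨Finset.mem_univ _, ?_⟩
    rw [filter_ind_eq_zero, Finset.card_pair hab]
  have hnR : (0 : ℝ) < n := by exact_mod_cast hnpos
  -- normalise and apply the variational principle
  set c : ℝ := 1 / Real.sqrt n with hc
  have hc2 : c * c * (n : ℝ) = 1 := by
    rw [hc, div_mul_div_comm, one_mul, Real.mul_self_sqrt hnR.le, one_div, inv_mul_cancel₀ hnR.ne']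
  set ψ : TensorIndex (TorusSite 3 L) 2 → ℂ := (c : ℂ) • φ with hψ
  have hψmem : ψ ∈ spinZSector 1 (((2 : ℕ) : ℝ) - (L : ℝ) ^ 3 / 2) := Submodule.smul_mem _ _ hsec
  have hstar : star ψ = (c : ℂ) • star φ := by
    rw [hψ, star_smul, Complex.star_def, Complex.conj_ofReal]
  have h1 : star ψ ⬝ᵥ ψ = 1 := by
    rw [hstar, hψ, smul_dotProduct, dotProduct_smul, hnorm, smul_eq_mul, smul_eq_mul, ← mul_assoc]
    have : ((c * c * n : ℝ) : ℂ) = 1 := by rw [hc2]; simp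
    push_cast at this
    exact this
  have hray : (star ψ ⬝ᵥ (xyTorus 3 L 1 *ᵥ ψ)).re ≤ -5 := by
    rw [hstar, hψ, Matrix.mulVec_smul, smul_dotProduct, dotProduct_smul, smul_eq_mul, smul_eq_mul,
      ← mul_assoc, show ((c : ℂ) * (c : ℂ)) = ((c * c : ℝ) : ℂ) by push_cast; ring,
      Complex.re_ofReal_mul]
    have hcc : 0 ≤ c * c := mul_self_nonneg c
    calc c * c * (star φ ⬝ᵥ (xyTorus 3 L 1 *ᵥ φ)).re ≤ c * c * (-5 * n) :=
          mul_le_mul_of_nonneg_left hquad hcc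
      _ = -5 * (c * c * n) := by ring
      _ = -5 := by rw [hc2]; ring
  have hH : (xyTorus 3 L 1).IsHermitian := xxzZero_isHermitian (torusGraph 3 L) (-1)
  have hle := minEnergyOn_le_rayleigh_of_mem hH
    (spinZSector 1 (((2 : ℕ) : ℝ) - (L : ℝ) ^ 3 / 2)) hψmem h1
  unfold lowestEnergyInSector
  exact hle.trans hray


/-! ### `stub_poExcessBudget` of line `cosh-budget-penrose-onsager` needs the eigen-equation of `ψ'` -/

/-- **Any proof of `stub_poExcessBudget` must use that `ψ'` is a ground vector.** Delete the
eigen-equation from the admissibility of `ψ'` (keep: sector, `ψ' ≠ 0`, entrywise real nonnegative)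
and the `O(L⁻³)` Penrose–Onsager budget is FALSE. Witness: `N = 1`, `ψ' = δ_{1_{{0}}}` (one frozen
boson); its PO vector `Φ = A†ψ'` is the indicator of the two-sets `{0, x}`, `x ≠ 0`, so
`⟨Φ,HΦ⟩ ≥ -3‖Φ‖²` (only the free boson hops: at most six moves, `torus_degree_le_six`), while
`E(2) ≤ -5` (`lowestEnergy_two_le_neg_five`): the excess is `≥ 2‖Φ‖²`, not `≤ C_B‖Φ‖²/L³`.
(Statement = the registered def-free `stub_poExcessBudget` with the conjunct
`(xyTorus 3 L 1).mulVec ψ' = E(N) • ψ'` removed.) [folklore] -/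
theorem poExcessBudget_false_without_groundState : ¬
    (∃ C_B : ℝ, 0 ≤ C_B ∧ ∀ (L : ℕ) [NeZero L], 3 ≤ L → ∀ N : ℕ, 1 ≤ N → 2 * (N + 1) ≤ L ^ 3 →
      ∀ ψ' : TensorIndex (TorusSite 3 L) 2 → ℂ,
        (ψ' ∈ spinZSector 1 (((N : ℕ) : ℝ) - (L : ℝ) ^ 3 / 2) ∧ ψ' ≠ 0 ∧
          ∀ σ, 0 ≤ (ψ' σ).re ∧ (ψ' σ).im = 0) →
        (star ((fun σ => ∑ x, if σ x = 0 then (ψ') (Function.update σ x 1) else 0)) ⬝ᵥ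
            (xyTorus 3 L 1).mulVec
              ((fun σ => ∑ x, if σ x = 0 then (ψ') (Function.update σ x 1) else 0))).re -
          lowestEnergyInSector 1 (xyTorus 3 L 1) (((N + 1 : ℕ) : ℝ) - (L : ℝ) ^ 3 / 2) *
            (star ((fun σ => ∑ x, if σ x = 0 then (ψ') (Function.update σ x 1) else 0)) ⬝ᵥ
              ((fun σ => ∑ x, if σ x = 0 then (ψ') (Function.update σ x 1) else 0))).re ≤
          C_B / (L : ℝ) ^ 3 *
            (star ((fun σ => ∑ x, if σ x = 0 then (ψ') (Function.update σ x 1) else 0)) ⬝ᵥ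
              ((fun σ => ∑ x, if σ x = 0 then (ψ') (Function.update σ x 1) else 0))).re) := by
  rintro ⟨C_B, -, h⟩
  -- a large side `L ≥ 3` with `L³ > C_B / 2`
  obtain ⟨L, hL2, hLM⟩ := exists_side_gt (max (C_B / 2) 9)
  have hL9 : (9 : ℝ) < (L : ℝ) ^ 3 := lt_of_le_of_lt (le_max_right _ _) hLM
  have hLC : C_B / 2 < (L : ℝ) ^ 3 := lt_of_le_of_lt (le_max_left _ _) hLM
  have hL3 : 3 ≤ L := by
    by_contra h3
    have hL' : L = 2 := by omega
    rw [hL'] at hL9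
    norm_num at hL9
  haveI : NeZero L := ⟨by omega⟩
  have hL27 : 2 * (1 + 1) ≤ L ^ 3 :=
    calc 2 * (1 + 1) ≤ 3 ^ 3 := by norm_num
      _ ≤ L ^ 3 := Nat.pow_le_pow_left hL3 3
  -- the frozen boson at the origin
  set k : TorusSite 3 L := 0 with hk
  set ψ' : TensorIndex (TorusSite 3 L) 2 → ℂ :=
    bvec (fun z => if z ∈ ({k} : Finset (TorusSite 3 L)) then (0 : Fin 2) else 1) with hψ'
  have hsec : ψ' ∈ spinZSector 1 ((((1 : ℕ) : ℕ) : ℝ) - (L : ℝ) ^ 3 / 2) := by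
    refine bvec_ind_mem_spinZSector _ _ ?_
    rw [Finset.card_singleton, card_torusSite 3 L]
    push_cast
    ring
  have key := h L hL3 1 le_rfl hL27 ψ' ⟨hsec, bvec_ne_zero _, bvec_nonneg _⟩
  set Φ : TensorIndex (TorusSite 3 L) 2 → ℂ :=
    fun σ => ∑ x, if σ x = 0 then ψ' (Function.update σ x 1) else 0 with hΦ
  change (star Φ ⬝ᵥ (xyTorus 3 L 1 *ᵥ Φ)).re -
      lowestEnergyInSector 1 (xyTorus 3 L 1) (((1 + 1 : ℕ) : ℝ) - (L : ℝ) ^ 3 / 2) *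
        (star Φ ⬝ᵥ Φ).re ≤ C_B / (L : ℝ) ^ 3 * (star Φ ⬝ᵥ Φ).re at key
  -- the pair configurations `τ x = 1_{{x, k}}` and their set `T`
  set τ : TorusSite 3 L → TensorIndex (TorusSite 3 L) 2 :=
    fun x => fun z => if z ∈ insert x ({k} : Finset (TorusSite 3 L)) then (0 : Fin 2) else 1 with hτ
  set T : Finset (TensorIndex (TorusSite 3 L) 2) := (Finset.univ.erase k).image τ with hT
  -- `Φ σ` counts the sites `x` with `σ x = 0` and `σ` emptied at `x` equal to `1_{{k}}`
  have hΦval : ∀ σ, Φ σ = ((Finset.univ.filter fun x => σ x = 0 ∧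
      Function.update σ x 1 = fun z => if z ∈ ({k} : Finset (TorusSite 3 L)) then (0 : Fin 2) else 1).card : ℂ) := by
    intro σ
    simp only [hΦ, hψ', bvec_apply]
    rw [← Finset.sum_boole]
    refine Finset.sum_congr rfl fun x _ => ?_
    split_ifs <;> first | rfl | (exfalso; tauto)
  -- at most one such site
  have hA1 : ∀ σ, (Finset.univ.filter fun x => σ x = 0 ∧
      Function.update σ x 1 = fun z => if z ∈ ({k} : Finset (TorusSite 3 L)) then (0 : Fin 2) else 1).card ≤ 1 := by
    intro σ
    refine Finset.card_le_one.mpr fun x hx x' hx' => ?_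
    rw [Finset.mem_filter] at hx hx'
    by_contra hne
    have h1 := congrFun hx.2.2 x
    have h2 := congrFun hx'.2.2 x
    rw [Function.update_self] at h1
    rw [Function.update_of_ne hne, hx.2.1] at h2
    rw [← h2] at h1
    exact absurd h1 (by decide)
  -- membership facts
  have hAτ : ∀ x, x ≠ k → x ∈ (Finset.univ.filter fun y => τ x y = 0 ∧
      Function.update (τ x) y 1 = fun z => if z ∈ ({k} : Finset (TorusSite 3 L)) then (0 : Fin 2) else 1) := by
    intro x hxk
    rw [Finset.mem_filter]
    refine ⟨Finset.mem_univ _, by simp [hτ], ?_⟩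
    funext z
    by_cases hz : z = x
    · subst hz
      rw [Function.update_self]
      simp [hxk]
    · rw [Function.update_of_ne hz]
      simp [hτ, hz]
  have hAσ : ∀ σ x, x ∈ (Finset.univ.filter fun y => σ y = 0 ∧
      Function.update σ y 1 = fun z => if z ∈ ({k} : Finset (TorusSite 3 L)) then (0 : Fin 2) else 1) →
      x ≠ k ∧ σ = τ x := by
    intro σ x hx
    rw [Finset.mem_filter] at hx
    obtain ⟨-, hx0, hup⟩ := hx
    have hxk : x ≠ k := by
      intro hxk
      have := congrFun hup x
      rw [Function.update_self, hxk] at this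
      simp at this
    refine ⟨hxk, funext fun z => ?_⟩
    by_cases hz : z = x
    · subst hz
      rw [hx0]
      simp [hτ]
    · have := congrFun hup z
      rw [Function.update_of_ne hz] at this
      rw [this]
      simp [hτ, hz]
  -- hence `Φ` is the indicator of `T`
  have hΦT : ∀ σ, Φ σ = if σ ∈ T then 1 else 0 := by
    intro σ
    rw [hΦval]
    by_cases hσ : σ ∈ T
    · rw [if_pos hσ]
      obtain ⟨x, hx, rfl⟩ := Finset.mem_image.mp hσ
      have hxk : x ≠ k := Finset.ne_of_mem_erase hx
      have hle := hA1 (τ x)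
      have hge : 1 ≤ (Finset.univ.filter fun y => τ x y = 0 ∧
          Function.update (τ x) y 1 = fun z => if z ∈ ({k} : Finset (TorusSite 3 L)) then (0 : Fin 2) else 1).card :=
        Finset.card_pos.mpr ⟨x, hAτ x hxk⟩
      have : (Finset.univ.filter fun y => τ x y = 0 ∧
          Function.update (τ x) y 1 = fun z => if z ∈ ({k} : Finset (TorusSite 3 L)) then (0 : Fin 2) else 1).card = 1 := by
        omega
      rw [this]; simp
    · rw [if_neg hσ]
      have : (Finset.univ.filter fun y => σ y = 0 ∧
          Function.update σ y 1 = fun z => if z ∈ ({k} : Finset (TorusSite 3 L)) then (0 : Fin 2) else 1) = ∅ := by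
        by_contra hne
        obtain ⟨x, hx⟩ := Finset.nonempty_iff_ne_empty.mpr hne
        obtain ⟨hxk, rfl⟩ := hAσ σ x hx
        exact hσ (Finset.mem_image.mpr ⟨x, Finset.mem_erase.mpr ⟨hxk, Finset.mem_univ _⟩, rfl⟩)
      rw [this]; simp
  -- `‖Φ‖² = #T`
  have hns : star Φ ⬝ᵥ Φ = (T.card : ℂ) := by
    rw [dotProduct]
    have hterm : ∀ σ : TensorIndex (TorusSite 3 L) 2, star Φ σ * Φ σ = if σ ∈ T then (1 : ℂ) else 0 := by
      intro σ
      rw [Pi.star_apply, hΦT σ]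
      split_ifs <;> simp
    rw [Finset.sum_congr rfl fun σ _ => hterm σ, Finset.sum_boole]
    congr 1
    congr 1
    ext σ
    simp
  -- `Re (HΦ)(τ x) ≥ -3` for `x ≠ k`: only the free boson hops
  have hrow : ∀ x, x ≠ k → -3 ≤ ((xyTorus 3 L 1 *ᵥ Φ) (τ x)).re := by
    intro x hxk
    have hτx : τ x = fun z => if z ∈ insert x ({k} : Finset (TorusSite 3 L)) then (0 : Fin 2) else 1 := rfl
    rw [hτx, show xyTorus 3 L 1 = xxzHamiltonian 1 (torusGraph 3 L) (-1) 0 from rfl,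
      Cruxes.InsertionFieldDelocalisation.MobileTrapDirichletEigenfunction.mt3em_xxzZero_mulVec_ind]
    set S : Finset (TorusSite 3 L) := insert x {k} with hS
    -- the summands as real indicators
    have hterm : ∀ a ∈ S, ∀ b : TorusSite 3 L,
        (if b ∉ S ∧ (torusGraph 3 L).Adj a b then
          Φ (fun z => if z ∈ insert b (S.erase a) then 0 else 1) else 0) =
        ((if (b ∉ S ∧ (torusGraph 3 L).Adj a b) ∧
            (fun z => if z ∈ insert b (S.erase a) then (0 : Fin 2) else 1) ∈ T then (1 : ℝ) else 0 : ℝ) : ℂ) := by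
      intro a _ b
      rw [hΦT]
      by_cases h1 : b ∉ S ∧ (torusGraph 3 L).Adj a b
      · by_cases h2 : (fun z => if z ∈ insert b (S.erase a) then (0 : Fin 2) else 1) ∈ T
        · rw [if_pos h1, if_pos h2, if_pos ⟨h1, h2⟩]; simp
        · rw [if_pos h1, if_neg h2, if_neg (fun h => h2 h.2)]; simp
      · rw [if_neg h1, if_neg (fun h => h1 h.1)]; simp
    rw [Finset.sum_congr rfl fun a ha => Finset.sum_congr rfl fun b _ => hterm a ha b]
    have hcast : (∑ a ∈ S, ∑ b : TorusSite 3 L,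
        (((if (b ∉ S ∧ (torusGraph 3 L).Adj a b) ∧
            (fun z => if z ∈ insert b (S.erase a) then (0 : Fin 2) else 1) ∈ T then (1 : ℝ) else 0 : ℝ)) : ℂ)) =
        ((∑ a ∈ S, ∑ b : TorusSite 3 L,
          (if (b ∉ S ∧ (torusGraph 3 L).Adj a b) ∧
            (fun z => if z ∈ insert b (S.erase a) then (0 : Fin 2) else 1) ∈ T then (1 : ℝ) else 0) : ℝ) : ℂ) := by
      rw [Complex.ofReal_sum]
      exact Finset.sum_congr rfl fun a _ => (Complex.ofReal_sum _ _).symm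
    rw [hcast, ← Complex.ofReal_mul, Complex.ofReal_re]
    -- the double sum is at most `6`: the `a = k` terms vanish, the `a = x` terms are `≤ deg x ≤ 6`
    have hxS : (insert x ({k} : Finset (TorusSite 3 L))).erase k = {x} := by
      rw [Finset.erase_insert_of_ne hxk, Finset.erase_singleton]
      rfl
    have hkterm : ∀ b : TorusSite 3 L,
        (if (b ∉ S ∧ (torusGraph 3 L).Adj k b) ∧
            (fun z => if z ∈ insert b (S.erase k) then (0 : Fin 2) else 1) ∈ T then (1 : ℝ) else 0) = 0 := by
      intro b
      rw [if_neg]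
      rintro ⟨⟨hbS, -⟩, hmem⟩
      rw [hS, hxS] at hmem
      obtain ⟨y, hy, hyeq⟩ := Finset.mem_image.mp hmem
      have hsets : insert y ({k} : Finset (TorusSite 3 L)) = insert b {x} := (ind_eq_ind_iff _ _).mp hyeq
      have hkmem : k ∈ insert b ({x} : Finset (TorusSite 3 L)) := by
        rw [← hsets]; simp
      rw [Finset.mem_insert, Finset.mem_singleton] at hkmem
      rcases hkmem with rfl | rfl
      · exact hbS (by rw [hS]; simp)
      · exact hxk rfl
    have hxterm : ∀ b : TorusSite 3 L,
        (if (b ∉ S ∧ (torusGraph 3 L).Adj x b) ∧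
            (fun z => if z ∈ insert b (S.erase x) then (0 : Fin 2) else 1) ∈ T then (1 : ℝ) else 0) ≤
          if (torusGraph 3 L).Adj x b then (1 : ℝ) else 0 := by
      intro b
      split_ifs with h1 h2
      · exact le_rfl
      · exact absurd h1.1.2 h2
      · norm_num
      · exact le_rfl
    have hdeg := torus_degree_le_six x
    have hsum6 : (∑ a ∈ S, ∑ b : TorusSite 3 L,
          (if (b ∉ S ∧ (torusGraph 3 L).Adj a b) ∧
            (fun z => if z ∈ insert b (S.erase a) then (0 : Fin 2) else 1) ∈ T then (1 : ℝ) else 0)) ≤ 6 := by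
      rw [hS, Finset.sum_insert (by simpa using hxk), Finset.sum_singleton, ← hS]
      rw [Finset.sum_congr rfl fun b _ => hkterm b, Finset.sum_const_zero, add_zero]
      calc (∑ b : TorusSite 3 L,
            (if (b ∉ S ∧ (torusGraph 3 L).Adj x b) ∧
              (fun z => if z ∈ insert b (S.erase x) then (0 : Fin 2) else 1) ∈ T then (1 : ℝ) else 0))
          ≤ ∑ b : TorusSite 3 L, (if (torusGraph 3 L).Adj x b then (1 : ℝ) else 0) :=
            Finset.sum_le_sum fun b _ => hxterm b
        _ = ((Finset.univ.filter fun y => (torusGraph 3 L).Adj x y).card : ℝ) := by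
            rw [Finset.sum_boole]
        _ ≤ 6 := by exact_mod_cast hdeg
    linarith
  -- `Re ⟨Φ, HΦ⟩ ≥ -3 #T`
  have hqf : -3 * (T.card : ℝ) ≤ (star Φ ⬝ᵥ (xyTorus 3 L 1 *ᵥ Φ)).re := by
    rw [dotProduct, Complex.re_sum]
    have hterm : ∀ σ : TensorIndex (TorusSite 3 L) 2,
        (if σ ∈ T then (-3 : ℝ) else 0) ≤ (star Φ σ * (xyTorus 3 L 1 *ᵥ Φ) σ).re := by
      intro σ
      rw [Pi.star_apply, hΦT σ]
      by_cases hσ : σ ∈ T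
      · rw [if_pos hσ, if_pos hσ, star_one, one_mul]
        obtain ⟨x, hx, rfl⟩ := Finset.mem_image.mp hσ
        exact hrow x (Finset.ne_of_mem_erase hx)
      · rw [if_neg hσ, if_neg hσ, star_zero, zero_mul, Complex.zero_re]
    calc -3 * (T.card : ℝ) = ∑ σ : TensorIndex (TorusSite 3 L) 2, (if σ ∈ T then (-3 : ℝ) else 0) := by
          rw [Finset.sum_ite_mem, Finset.univ_inter, Finset.sum_const, nsmul_eq_mul, mul_comm]
      _ ≤ _ := Finset.sum_le_sum fun σ _ => hterm σ
  -- `#T > 0`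
  have hTpos : 0 < T.card := by
    rw [hT, Finset.card_pos]
    have hcard : 0 < (Finset.univ.erase k).card := by
      rw [Finset.card_erase_of_mem (Finset.mem_univ _), Finset.card_univ, card_torusSite 3 L]
      have : 27 ≤ L ^ 3 := Nat.pow_le_pow_left hL3 3
      omega
    obtain ⟨x₀, hx₀⟩ := Finset.card_pos.mp hcard
    exact ⟨τ x₀, Finset.mem_image_of_mem _ hx₀⟩
  -- `E(2) ≤ -5`
  have hE := lowestEnergy_two_le_neg_five hL3
  rw [show (((2 : ℕ) : ℝ)) = ((1 + 1 : ℕ) : ℝ) by norm_num] at hE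
  -- assemble
  rw [hns] at key
  simp only [Complex.natCast_re] at key
  set ns : ℝ := (T.card : ℝ) with hnsdef
  set E : ℝ := lowestEnergyInSector 1 (xyTorus 3 L 1) (((1 + 1 : ℕ) : ℝ) - (L : ℝ) ^ 3 / 2) with hEdef
  set qf : ℝ := (star Φ ⬝ᵥ (xyTorus 3 L 1 *ᵥ Φ)).re with hqfdef
  have hnspos : (0 : ℝ) < ns := by rw [hnsdef]; exact_mod_cast hTpos
  have hL0 : (0 : ℝ) < (L : ℝ) ^ 3 := by positivity
  have h2 : 2 * ns ≤ C_B / (L : ℝ) ^ 3 * ns := by nlinarith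
  have h3 : (2 : ℝ) ≤ C_B / (L : ℝ) ^ 3 := le_of_mul_le_mul_right h2 hnspos
  rw [le_div_iff₀ hL0] at h3
  linarith


end Summit.AtomisticToContinuum.BoseEinsteinCondensation.Cruxes.InsertionFieldDelocalisation.DrefuteCoshBudget

end
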